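import Summits.ResolutionOfSingularities.ResolutionOfSingularities.Theorems.PurelyInseparableDim4ResConeLedgerPersist
import HarnessLib
import HarnessLib.Audit.Tags

/-!
# Purely inseparable four-folds — LEVEL-2 ABSORPTION: the vertex one level down at a self-chart step
# (cell `res-dim4-pi`, K2(p) lane, slice B brick K20)

[OURS · counted 0 · cell `res-dim4-pi` · K2(p) lane holder res-dim4-p-12 g3's brick by signature (bus
2026-08-29 00:25Z, SLICE-B-ARCH v1.4 §9 K7-prep; derivation idea-4 g3), seat res-dim4-p-9 g3.]  Nothing here
proves K2(p), `NoIsolatedTrap p p` or resolution of singularities in dimension ≥ 4 / characteristic `p`;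
K16–K20 are the bookkeeping of the light regime (I-4-7 classes A∞/C∞) only.

At a SELF-CHART step (chart letter `a` = a ledger letter, `b_a = 0`) the level-2 cofactor transports as
`S′ ≡ U · chartTransform (d−1) univ a (shear a b S) (mod x_a x_{b′})` with a unit `U` (K19, res-dim4-p-3), and at
the child `ord S′ ≥ d − 1` again (K16).  This file turns the two facts into «(VT)(i) one level down»:

* `coeff_eq_zero_of_unit_mul` / `homogeneousComponent_mem_span_monomial_of_mul_unit` — TRIANGULAR INDUCTION:
  if `U(0) ≠ 0` and the low homogeneous parts of `U·T` lie in the monomial ideal `(x_a x_{b′})`, so do those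
  of `T` (coefficientwise: a monomial below degree `m₀` not divisible by `x_a x_{b′}` has coefficient `0`).
* **`levelTwo_shear_cone_free`** — hence every monomial of `chartTransform (d−1) (shear a b S)` below degree
  `d − 1` is divisible by `x_a x_{b′}`; but a monomial `x^e` of `shear a b (in_{d−1} S)` with `e_a = t ≥ 1`
  would map to `x^{e.update a 0}` of degree `d − 1 − t`, NOT divisible by `x_a` (injective chart exponent,
  `coeff_chartTransform_chartExponent'`) — so `shear a b (in_{d−1} S)` is `x_a`-FREE;
* **`levelTwo_direction_mem_additiveSubspace`** — therefore the step direction lies in the polar kernel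
  (vertex) of the level-2 cone `in_{d−1} S` (`ResCone.direction_mem_additiveSubspace_of_shear_free`).

The binder block is reduced to what the proofs read (`b a = 0`, a unit `U`, `hS`, `hrel`, `hord′`); K19's block
instantiates it (`U :=` the lost units).  The THIRD-LETTER chart (extra factor `x_j`, K17) is NOT treated here.
bears_on: LADDER-RESOLUTION:D157-DOOR2 (res-dim4-pi · K2(p) · slice B · K20).  Supports
stmt-ResolutionOfSingularities-16155 (helper).
-/

set_option linter.dupNamespace false -- mandated namespace of this single-conjunct summit

noncomputable section

namespace Summit.ResolutionOfSingularities.ResolutionOfSingularities.Theorems.PIDim4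

namespace ResCone

open MvPolynomial Finset
open Literature.AlgebraicGeometry.Resolution
open Literature.AlgebraicGeometry.Resolution.CentreBlowup
open Literature.AlgebraicGeometry.Resolution.Hauser2010
open Literature.AlgebraicGeometry.Resolution.HauserPerlega2019
open PointBlowup (additiveSubspace direction)

variable {K : Type} [Field K]

/-! ## 1. The monomial ideal `(x_a x_{b′})` and the triangular induction -/

/-- Membership in `(x_a x_{b′})` is coefficientwise: every monomial is divisible by `x_a x_{b′}`. [folklore] -/
theorem mem_span_X_mul_X_iff (a b' : Fin 4) (P : MvPolynomial (Fin 4) K) :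
    P ∈ Ideal.span {(X a * X b' : MvPolynomial (Fin 4) K)} ↔
      ∀ e ∈ P.support, Finsupp.single a 1 + Finsupp.single b' 1 ≤ e := by
  have h : ({(X a * X b' : MvPolynomial (Fin 4) K)} : Set (MvPolynomial (Fin 4) K)) =
      (fun s => monomial s (1 : K)) '' {Finsupp.single a 1 + Finsupp.single b' 1} := by
    rw [Set.image_singleton, X, X, monomial_mul, one_mul]
  rw [h, mem_ideal_span_monomial_image]
  exact forall₂_congr fun e _ => by simp

/-- A polynomial in `(x_a x_{b′})` has no monomial prime to `x_a x_{b′}`. [folklore] -/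
theorem coeff_eq_zero_of_mem_span_X_mul_X {a b' : Fin 4} {P : MvPolynomial (Fin 4) K}
    (hP : P ∈ Ideal.span {(X a * X b' : MvPolynomial (Fin 4) K)}) {e : Fin 4 →₀ ℕ}
    (he : ¬ Finsupp.single a 1 + Finsupp.single b' 1 ≤ e) : coeff e P = 0 := by
  by_contra hne
  exact he ((mem_span_X_mul_X_iff a b' P).mp hP e (MvPolynomial.mem_support_iff.mpr hne))

/-- **Triangular induction, coefficient form**: if `U(0) ≠ 0` and every monomial of `U·T` of degree `< m₀` prime
to `x_a x_{b′}` has coefficient `0`, the same holds for `T` (strong induction on the degree: in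
`coeff_e (U·T) = U(0)·coeff_e T + Σ_{f ≠ 0} coeff_f U · coeff_{e−f} T` the other terms vanish by induction).
[folklore] -/
theorem coeff_eq_zero_of_unit_mul {a b' : Fin 4} {U T : MvPolynomial (Fin 4) K}
    (hU : MvPolynomial.eval (0 : Fin 4 → K) U ≠ 0) {m₀ : ℕ}
    (hUT : ∀ e : Fin 4 →₀ ℕ, e.degree < m₀ → ¬ Finsupp.single a 1 + Finsupp.single b' 1 ≤ e →
      coeff e (U * T) = 0) :
    ∀ e : Fin 4 →₀ ℕ, e.degree < m₀ → ¬ Finsupp.single a 1 + Finsupp.single b' 1 ≤ e → coeff e T = 0 := by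
  classical
  have hU0 : coeff 0 U ≠ 0 := by rw [MvPolynomial.eval_zero] at hU; exact hU
  suffices key : ∀ n, ∀ e : Fin 4 →₀ ℕ, e.degree = n → n < m₀ →
      ¬ Finsupp.single a 1 + Finsupp.single b' 1 ≤ e → coeff e T = 0 from
    fun e he hne => key e.degree e rfl he hne
  intro n
  induction n using Nat.strong_induction_on with
  | _ n ih =>
    intro e hen hn hne
    have h := hUT e (hen ▸ hn) hne
    have h0mem : ((0 : Fin 4 →₀ ℕ), e) ∈ Finset.HasAntidiagonal.antidiagonal e :=
      Finset.HasAntidiagonal.mem_antidiagonal.mpr (zero_add e)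
    rw [coeff_mul, ← Finset.add_sum_erase _ _ h0mem] at h
    have hrest : ∑ x ∈ (Finset.HasAntidiagonal.antidiagonal e).erase (0, e), coeff x.1 U * coeff x.2 T = 0 := by
      refine Finset.sum_eq_zero fun x hx => ?_
      obtain ⟨hxne, hx⟩ := Finset.mem_erase.mp hx
      rw [Finset.HasAntidiagonal.mem_antidiagonal] at hx
      have hdeg : x.1.degree + x.2.degree = e.degree := by rw [← map_add, hx]
      have h1 : x.1.degree ≠ 0 := by
        intro h0
        rw [Finsupp.degree_eq_zero_iff] at h0
        apply hxne
        rw [Prod.ext_iff]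
        exact ⟨h0, by simpa [h0] using hx⟩
      have hle : x.2 ≤ e := by rw [← hx]; exact le_add_self
      rw [ih x.2.degree (by omega) x.2 rfl (by omega) (fun h2 => hne (h2.trans hle)), mul_zero]
    rw [hrest, add_zero] at h
    exact (mul_eq_zero.mp h).resolve_left hU0

/-- **Triangular induction, homogeneous form** (brick K20 (i)): if `U(0) ≠ 0` and the homogeneous parts of
`U·T` below degree `m₀` lie in `(x_a x_{b′})`, so do those of `T`. [folklore] -/
theorem homogeneousComponent_mem_span_monomial_of_mul_unit {a b' : Fin 4} {U T : MvPolynomial (Fin 4) K}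
    (hU : MvPolynomial.eval (0 : Fin 4 → K) U ≠ 0) {m₀ : ℕ}
    (hUT : ∀ m, m < m₀ → homogeneousComponent m (U * T) ∈ Ideal.span {(X a * X b' : MvPolynomial (Fin 4) K)}) :
    ∀ m, m < m₀ → homogeneousComponent m T ∈ Ideal.span {(X a * X b' : MvPolynomial (Fin 4) K)} := by
  classical
  have hcoef := coeff_eq_zero_of_unit_mul (a := a) (b' := b') (T := T) hU (m₀ := m₀) (fun e he hne => by
    have h := coeff_eq_zero_of_mem_span_X_mul_X (hUT e.degree he) hne
    rwa [coeff_homogeneousComponent, if_pos rfl] at h)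
  intro m hm
  rw [mem_span_X_mul_X_iff]
  intro e he
  by_contra hne
  rw [MvPolynomial.mem_support_iff, coeff_homogeneousComponent] at he
  split_ifs at he with hdeg
  · exact he (hcoef e (hdeg ▸ hm) hne)
  · exact he rfl

/-! ## 2. The level-2 cone is `x_a`-free after the shear: the vertex one level down -/

/-- Degree of the chart exponent in the chart letter's own direction: `|e′| + e_a = |e|` for `e′ = e.update a (|e| − m)`
with `m = |e|`… here only the special case `m = |e|` is needed: `|chartExponent |e| univ a e| = |e| − e_a`. [folklore] -/
theorem degree_chartExponent_self_degree (a : Fin 4) (e : Fin 4 →₀ ℕ) :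
    (chartExponent e.degree Finset.univ a e).degree + e a = e.degree := by
  have h : chartExponent e.degree Finset.univ a e + Finsupp.single a (e a) = e := by
    ext i
    by_cases hia : i = a
    · rw [hia, Finsupp.add_apply, chartExponent_univ_apply_self, Finsupp.single_eq_same, Nat.sub_self, zero_add]
    · rw [Finsupp.add_apply, chartExponent_apply_of_ne _ _ hia, Finsupp.single_eq_of_ne hia, add_zero]
  conv_rhs => rw [← h]
  rw [map_add, Finsupp.degree_single]

/-- **LEVEL-2 CONE IS `x_a`-FREE** (brick K20 (ii)): if `U(0) ≠ 0`, `ord S ≥ d − 1`,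
`S′ ≡ U · chartTransform (d−1) univ a (shear a b S) (mod x_a x_{b′})` and `ord S′ ≥ d − 1`, then
`shear a b (in_{d−1} S)` has no monomial involving `x_a`: a monomial `x^e` (`|e| = d − 1`, `e_a = t ≥ 1`) would give
the monomial `x^{e.update a 0}` of degree `d − 1 − t` of the chart transform, prime to `x_a`, with the same
coefficient — but below degree `d − 1` the chart transform lies in `(x_a x_{b′})` (triangular induction).
[OURS] [cite: CossartJannsenSaito2020, Thm. 3.10(4), Thm. 9.3] -/
theorem levelTwo_shear_cone_free [DecidableEq K] {a b' : Fin 4} (b : Fin 4 → K)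
    {S S' U : MvPolynomial (Fin 4) K} {d : ℕ} (hU : MvPolynomial.eval (0 : Fin 4 → K) U ≠ 0)
    (hS : ∀ m ∈ S.support, d - 1 ≤ m.degree)
    (hrel : S' - U * chartTransform (d - 1) Finset.univ a (shear a b S) ∈
      Ideal.span {(X a * X b' : MvPolynomial (Fin 4) K)})
    (hord' : ∀ m ∈ S'.support, d - 1 ≤ m.degree) :
    ∀ e ∈ (shear a b (homogeneousComponent (d - 1) S)).support, e a = 0 := by
  set W := chartTransform (d - 1) Finset.univ a (shear a b S) with hW
  -- (1) below degree `d − 1`, `U·W ≡ S′ ≡ 0 (mod x_a x_{b′})`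
  have h1 : ∀ e : Fin 4 →₀ ℕ, e.degree < d - 1 → ¬ Finsupp.single a 1 + Finsupp.single b' 1 ≤ e →
      coeff e (U * W) = 0 := by
    intro e he hne
    have hS'0 : coeff e S' = 0 := by
      by_contra h
      exact absurd (hord' e (MvPolynomial.mem_support_iff.mpr h)) (by omega)
    have h2 := coeff_eq_zero_of_mem_span_X_mul_X hrel hne
    rw [coeff_sub, hS'0, zero_sub, neg_eq_zero] at h2
    exact h2
  -- (2) triangular induction: the same for `W`
  have h2 := coeff_eq_zero_of_unit_mul hU h1
  -- (3) a monomial of `shear (in_{d−1} S)` with `e_a ≥ 1` contradicts (2)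
  intro e he
  by_contra hea
  have hhom := isHomogeneous_shear a b (homogeneousComponent_isHomogeneous (d - 1) S)
    (MvPolynomial.mem_support_iff.mp he)
  rw [weight_one_eq_degree] at hhom
  have hcoef : coeff e (shear a b S) ≠ 0 := by
    rw [coeff_shear_eq_coeff_shear_homogeneousComponent a b S hhom]
    exact MvPolynomial.mem_support_iff.mp he
  have hq : ((d - 1 : ℕ) : ℕ∞) ≤ ordAlong Finset.univ (shear a b S) :=
    le_ordAlong_of_forall fun m hm => by rw [degIn_univ]; exact forall_le_degree_shear a b hS m hm
  have hW' : coeff (chartExponent (d - 1) Finset.univ a e) W = coeff e (shear a b S) :=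
    coeff_chartTransform_chartExponent' hq hhom.ge
  have hdeg : (chartExponent (d - 1) Finset.univ a e).degree + e a = d - 1 := by
    rw [← hhom]; exact degree_chartExponent_self_degree a e
  have hzero := h2 (chartExponent (d - 1) Finset.univ a e) (by omega) (fun hle => by
    have h := hle a
    rw [Finsupp.add_apply, Finsupp.single_eq_same, chartExponent_univ_apply_self, hhom, Nat.sub_self] at h
    omega)
  exact hcoef (hW' ▸ hzero)

/-- **THE VERTEX ONE LEVEL DOWN** (brick K20 (iii); «(VT)(i) one level down» for the self-chart steps of I-4-7's
classes A∞/C∞): under the hypotheses of `levelTwo_shear_cone_free` and `b_a = 0`, the step direction lies in the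
polar kernel of the level-2 cone `in_{d−1} S`. [OURS] [cite: CossartJannsenSaito2020, Thm. 3.10(4), Thm. 9.3] -/
theorem levelTwo_direction_mem_additiveSubspace [DecidableEq K] {a b' : Fin 4} {b : Fin 4 → K} (hba : b a = 0)
    {S S' U : MvPolynomial (Fin 4) K} {d : ℕ} (hU : MvPolynomial.eval (0 : Fin 4 → K) U ≠ 0)
    (hS : ∀ m ∈ S.support, d - 1 ≤ m.degree)
    (hrel : S' - U * chartTransform (d - 1) Finset.univ a (shear a b S) ∈
      Ideal.span {(X a * X b' : MvPolynomial (Fin 4) K)})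
    (hord' : ∀ m ∈ S'.support, d - 1 ≤ m.degree) :
    direction a b ∈ additiveSubspace (homogeneousComponent (d - 1) S) :=
  direction_mem_additiveSubspace_of_shear_free a hba (levelTwo_shear_cone_free b hU hS hrel hord')

end ResCone

end Summit.ResolutionOfSingularities.ResolutionOfSingularities.Theorems.PIDim4
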